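import Summits.NavierStokesRegularity.NavierStokesRegularity.Theorems.HodographBetchovClassBudgetsRegulariseProduction
import Summits.NavierStokesRegularity.NavierStokesRegularity.Theorems.HodographBetchovClassBudgetsRegulariseKeyEstimate

/-!
# Crux `HodographBetchov.ClassBudgetsRegularise` (stmt-NavierStokesRegularity-16863), line `birth` —
# the class-budget ledger at a fixed time (helper for stub 1)

The velocity-class form of Miller's enstrophy inequality at one time slice of a classical solution in
Tao's class (`classLedger_slice`): with `S = {‖v‖ ≤ l}` (slow class), `F = {l < ‖v‖}` (fast class),
`ω = curl v`, `P = ⟪ω, ∇v ω⟫` the production density, and a nonnegative (not necessarily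
measurable) two-frame majorant `m` of the middle strain eigenvalue on `F` with `∫_F m^p < ∞`,
`p > 3/2`:

  `∫ Σᵢ ⟪∂ᵢv, ∂ᵢW⟫ ≤ ∫_S P + κ(θ, ν) (2 ‖m 1_F‖_p K_S^{2(1−θ)})^{1/θ} ∫ |∇v|²_F`,  `θ = 1 − 3/(2p)`.

Proof: the production identity `∫Σᵢ⟪∂ᵢv, ∂ᵢW⟫ = −ν∫‖Δv‖² + ∫P` (`enstrophy_production_identity`);
split `∫P = ∫_S P + ∫_F P`; on the fast class `∫_F P = ∫_F (P − 4 det ∇v)` because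
`∫_F det ∇v = ∫ det ∇v − ∫_S det ∇v = 0 − 0` (the null-Lagrangian identities of
`…Hodograph.lean`); pointwise `P − 4 det ∇v ≤ 2 g |∇v|²_F` with the effective measurable majorant
`g ≤ m` on `F` (`…Algebra.lean`: Betchov's split + Miller's Lemma 5.1); finally the weighted
Gagliardo–Nirenberg absorption `2 Σⱼ ∫ (g 1_F) ‖∂ⱼv‖² ≤ (ν/2)∫‖Δv‖² + κ ‖g 1_F‖_p^{1/θ} ∫|∇v|²_F`
(`two_mul_sum_integral_weight_le`) and `‖g 1_F‖_p ≤ ‖m 1_F‖_p`.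

References: E. Miller, Arch. Ration. Mech. Anal. 235 (2020), Thm. 1.1 / Lemma 5.1 (proof of
Thm. 5.2); R. Betchov, J. Fluid Mech. 1 (1956).
-/

noncomputable section

open MeasureTheory Set Function Filter Topology InnerProductSpace
open scoped ENNReal NNReal ContDiff RealInnerProductSpace Laplacian

-- the summit and its single sub-problem share the name (CONVENTIONS §1), as in every Theorems file
set_option linter.dupNamespace false

namespace Summit.NavierStokesRegularity.NavierStokesRegularity.Theorems.ClassBudgetsRegularise

open Literature.Analysis Literature.Analysis.FluidPDE

/-- The effective majorant is bounded by a multiple of `‖∇v‖`: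
`g ≤ ½ (‖curlCLM‖² + 2) ‖∇v(x)‖` (`|P| ≤ ‖curlCLM‖² ‖∇v‖ |∇v|²_F`, `4|det ∇v| ≤ 2‖∇v‖ |∇v|²_F`).
[folklore] -/
theorem effMajorant_le_norm (v : EuclideanSpace ℝ (Fin 3) → EuclideanSpace ℝ (Fin 3))
    {x : EuclideanSpace ℝ (Fin 3)} (hv : DifferentiableAt ℝ v x) :
    max 0 (⟪curl v x, fderiv ℝ v x (curl v x)⟫ - 4 * (fderiv ℝ v x).det) /
        (2 * frobeniusNormSq (fderiv ℝ v x)) ≤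
      (‖curlCLM‖ ^ 2 + 2) / 2 * ‖fderiv ℝ v x‖ := by
  set A := fderiv ℝ v x with hA
  have hrhs : 0 ≤ (‖curlCLM‖ ^ 2 + 2) / 2 * ‖A‖ := by positivity
  rcases eq_or_lt_of_le (frobeniusNormSq_nonneg A) with h0 | hpos
  · rw [← h0]; simpa using hrhs
  have hω : ‖curl v x‖ ≤ ‖curlCLM‖ * ‖A‖ := norm_curl_le v x
  have hsq : ‖A‖ ^ 2 ≤ frobeniusNormSq A := FluidPDE.sq_opNorm_le_frobeniusNormSq A
  have hP : |⟪curl v x, A (curl v x)⟫| ≤ ‖curlCLM‖ ^ 2 * ‖A‖ * frobeniusNormSq A := by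
    calc |⟪curl v x, A (curl v x)⟫| ≤ ‖curl v x‖ * ‖A (curl v x)‖ := abs_real_inner_le_norm _ _
      _ ≤ ‖curl v x‖ * (‖A‖ * ‖curl v x‖) := by gcongr; exact A.le_opNorm _
      _ = ‖A‖ * ‖curl v x‖ ^ 2 := by ring
      _ ≤ ‖A‖ * (‖curlCLM‖ * ‖A‖) ^ 2 := by gcongr
      _ = ‖curlCLM‖ ^ 2 * ‖A‖ * ‖A‖ ^ 2 := by ring
      _ ≤ ‖curlCLM‖ ^ 2 * ‖A‖ * frobeniusNormSq A := by gcongr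
  have hdet : |A.det| ≤ (1 / 2) * ‖A‖ * frobeniusNormSq A := abs_det_fderiv_le hv
  have hnum : max 0 (⟪curl v x, A (curl v x)⟫ - 4 * A.det) ≤ (‖curlCLM‖ ^ 2 + 2) * ‖A‖ * frobeniusNormSq A := by
    refine max_le (by positivity) ?_
    have h1 : ⟪curl v x, A (curl v x)⟫ ≤ ‖curlCLM‖ ^ 2 * ‖A‖ * frobeniusNormSq A :=
      (le_abs_self _).trans hP
    have h2 : -(4 * A.det) ≤ 2 * ‖A‖ * frobeniusNormSq A := by
      have := neg_abs_le A.det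
      nlinarith [hdet, this, abs_nonneg A.det]
    nlinarith [h1, h2]
  rw [div_le_iff₀ (by positivity)]
  calc max 0 (⟪curl v x, A (curl v x)⟫ - 4 * A.det) ≤ (‖curlCLM‖ ^ 2 + 2) * ‖A‖ * frobeniusNormSq A := hnum
    _ = (‖curlCLM‖ ^ 2 + 2) / 2 * ‖A‖ * (2 * frobeniusNormSq A) := by ring

set_option maxHeartbeats 400000 in
/-- **The class-budget ledger at a fixed time** (Miller 2019, proof of Thm. 5.2, LOCALISED to the
fast velocity class; the new step of the route). Let `v ∈ C³(ℝ³; ℝ³)` be divergence free, bounded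
with bounded gradient, `W, q ∈ C¹`, `W + (v·∇)v = νΔv − ∇q` (`ν > 0`), `Dv, D²v, D³v, W, DW, q,
Dq ∈ L²` (a slice of a Tao-class solution). Let `l > 0`, let `m ≥ 0` be, at every fast point
`l < ‖v x‖`, a two-frame (Courant–Fischer) majorant of the quadratic form of `∇v(x)`, and let
`∫_{l<‖v‖} m^p < ∞` for some `p > 3/2`. Then, with `θ = 1 − 3/(2p)`, `N = (∫_{l<‖v‖} m^p)^{1/p}`,
`K_S` the Sobolev constant:
`∫ Σᵢ⟪∂ᵢv, ∂ᵢW⟫ ≤ ∫_{‖v‖≤l} ⟪ω, ∇v ω⟫ + θ (2(1−θ))^{(1−θ)/θ} ν^{−(1−θ)/θ} (2 N K_S^{2(1−θ)})^{1/θ} ∫ |∇v|²_F`.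
Proof: production identity; class split; `∫_F det ∇v = 0` (null-Lagrangian identities, global
minus slow); Betchov–Miller pointwise bound through the effective majorant; weighted
Gagliardo–Nirenberg absorption. [cite: Miller2019, Thm 1.1 (proof of Thm 5.2) and Lemma 5.1] -/
theorem classLedger_slice {ν : ℝ} (hν : 0 < ν)
    {v W : EuclideanSpace ℝ (Fin 3) → EuclideanSpace ℝ (Fin 3)} {q : EuclideanSpace ℝ (Fin 3) → ℝ}
    (hv : ContDiff ℝ 3 v) (hW : ContDiff ℝ 1 W) (hq : ContDiff ℝ 1 q)
    (hmom : ∀ x, W x + FluidPDE.convect v v x = ν • (Δ v) x - gradient q x)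
    (hdiv : VectorCalculus.IsDivFree v) {B : ℝ} (hB : ∀ x, ‖v x‖ ≤ B)
    {K : ℝ} (hK : ∀ x, ‖fderiv ℝ v x‖ ≤ K)
    (hv1 : ∫⁻ x, ‖iteratedFDeriv ℝ 1 v x‖ₑ ^ 2 < ⊤) (hv2 : ∫⁻ x, ‖iteratedFDeriv ℝ 2 v x‖ₑ ^ 2 < ⊤)
    (hv3 : ∫⁻ x, ‖iteratedFDeriv ℝ 3 v x‖ₑ ^ 2 < ⊤)
    (hW0 : ∫⁻ x, ‖W x‖ₑ ^ 2 < ⊤) (hW1 : ∫⁻ x, ‖iteratedFDeriv ℝ 1 W x‖ₑ ^ 2 < ⊤)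
    (hq0 : ∫⁻ x, ‖q x‖ₑ ^ 2 < ⊤) (hq1 : ∫⁻ x, ‖iteratedFDeriv ℝ 1 q x‖ₑ ^ 2 < ⊤)
    {l : ℝ} (hl : 0 < l) {m : EuclideanSpace ℝ (Fin 3) → ℝ} (hm0 : ∀ x, 0 ≤ m x)
    (hcl : ∀ x, l < ‖v x‖ → ∃ a b : EuclideanSpace ℝ (Fin 3), ‖a‖ = 1 ∧ ‖b‖ = 1 ∧ ⟪a, b⟫ = 0 ∧
      ∀ α β : ℝ, ⟪fderiv ℝ v x (α • a + β • b), α • a + β • b⟫ ≤ m x * (α ^ 2 + β ^ 2))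
    {p : ℝ} (hp : 3 / 2 < p)
    (hmp : ∫⁻ x in {x | l < ‖v x‖}, ENNReal.ofReal (m x) ^ p < ⊤) :
    ∫ x, ∑ i, ⟪fderiv ℝ v x (EuclideanSpace.basisFun (Fin 3) ℝ i),
        fderiv ℝ W x (EuclideanSpace.basisFun (Fin 3) ℝ i)⟫ ≤
      (∫ x in {x | ‖v x‖ ≤ l}, ⟪curl v x, fderiv ℝ v x (curl v x)⟫) +
        (1 - 3 / (2 * p)) * (2 * (1 - (1 - 3 / (2 * p)))) ^ ((1 - (1 - 3 / (2 * p))) / (1 - 3 / (2 * p))) *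
          ν ^ (-((1 - (1 - 3 / (2 * p))) / (1 - 3 / (2 * p)))) *
          (2 * ((∫⁻ x in {x | l < ‖v x‖}, ENNReal.ofReal (m x) ^ p) ^ (1 / p)).toReal *
            ((SNormLESNormFDerivOfEqConst (EuclideanSpace ℝ (Fin 3))
              (volume : Measure (EuclideanSpace ℝ (Fin 3))) 2 : ℝ) ^ (2 * (1 - (1 - 3 / (2 * p)))))) ^
            (1 / (1 - 3 / (2 * p))) *
          ∫ x, frobeniusNormSq (fderiv ℝ v x) := by
  set e := EuclideanSpace.basisFun (Fin 3) ℝ with he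
  set KS : ℝ := (SNormLESNormFDerivOfEqConst (EuclideanSpace ℝ (Fin 3))
    (volume : Measure (EuclideanSpace ℝ (Fin 3))) 2 : ℝ) with hKS
  set θ : ℝ := 1 - 3 / (2 * p) with hθ
  have hp0 : 0 < p := by linarith
  have hθ0 : 0 < θ := by
    rw [hθ, sub_pos, div_lt_one (by positivity)]; linarith
  have hθ1 : θ < 1 := by
    rw [hθ]; linarith [div_pos (zero_lt_three' ℝ) (by positivity : (0 : ℝ) < 2 * p)]
  have hKS0 : 0 ≤ KS := NNReal.coe_nonneg _
  have hB0 : 0 ≤ B := (norm_nonneg _).trans (hB 0)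
  have hK0 : 0 ≤ K := (norm_nonneg _).trans (hK 0)
  have hv2' : ContDiff ℝ 2 v := hv.of_le (by norm_num)
  have hv1' : ContDiff ℝ 1 v := hv.of_le (by norm_num)
  have hdv : ∀ x, DifferentiableAt ℝ v x := fun x => (hv.differentiable (by norm_num)) x
  have hdiv' : ∀ x, VectorCalculus.divergence v x = 0 := hdiv
  have cDv : Continuous (fderiv ℝ v) := hv.continuous_fderiv (by norm_num)
  -- the classes
  set S : Set (EuclideanSpace ℝ (Fin 3)) := {x | ‖v x‖ ≤ l} with hS
  set F : Set (EuclideanSpace ℝ (Fin 3)) := {x | l < ‖v x‖} with hF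
  have hSm : MeasurableSet S := (isClosed_le hv.continuous.norm continuous_const).measurableSet
  have hFm : MeasurableSet F := (isOpen_lt continuous_const hv.continuous.norm).measurableSet
  have hSc : Sᶜ = F := by ext x; simp [hS, hF, not_le]
  -- Step 1: the production identity
  have hprod := enstrophy_production_identity hv hW hq hmom hdiv hB hK hv1 hv2 hv3 hW0 hW1 hq0 hq1
  -- the production density `P`, the determinant, `|∇v|²_F`: integrability
  have hDv_eq : ∀ x, ‖fderiv ℝ v x‖ = ‖iteratedFDeriv ℝ 1 v x‖ := fun x => by
    rw [← norm_iteratedFDeriv_fderiv, norm_iteratedFDeriv_zero]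
  have l2Dv : ∫⁻ x, ‖fderiv ℝ v x‖ₑ ^ 2 < ⊤ :=
    lintegral_enorm_sq_lt_top_of_norm_le (fun x => (hDv_eq x).le) hv1
  have hfrob_int : Integrable (fun x => frobeniusNormSq (fderiv ℝ v x)) volume := by
    have lfrob : ∫⁻ x, ENNReal.ofReal (FluidPDE.frobeniusNormSq (fderiv ℝ v x)) < ⊤ :=
      calc ∫⁻ x, ENNReal.ofReal (FluidPDE.frobeniusNormSq (fderiv ℝ v x))
          ≤ ∫⁻ x, 3 * ‖fderiv ℝ v x‖ₑ ^ 2 :=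
            lintegral_mono fun x => ofReal_frobeniusNormSq_le_three_mul_enorm_sq _
        _ = 3 * ∫⁻ x, ‖fderiv ℝ v x‖ₑ ^ 2 := lintegral_const_mul' _ _ (by norm_num)
        _ < ⊤ := ENNReal.mul_lt_top (by norm_num) l2Dv
    exact integrable_of_continuous_of_nonneg (FluidPDE.continuous_frobeniusNormSq_fderiv hv (by simp))
      (fun x => FluidPDE.frobeniusNormSq_nonneg _) lfrob
  have cP : Continuous fun x => ⟪curl v x, fderiv ℝ v x (curl v x)⟫ :=
    (continuous_curl hv1').inner (cDv.clm_apply (continuous_curl hv1'))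
  have cdet : Continuous fun x => (fderiv ℝ v x).det := ContinuousLinearMap.continuous_det.comp cDv
  have idet : Integrable (fun x => (fderiv ℝ v x).det) volume := by
    refine Integrable.mono' (hfrob_int.const_mul ((1 / 2) * K)) cdet.aestronglyMeasurable
      (Eventually.of_forall fun x => ?_)
    rw [Real.norm_eq_abs]
    calc |(fderiv ℝ v x).det| ≤ (1 / 2) * ‖fderiv ℝ v x‖ * frobeniusNormSq (fderiv ℝ v x) :=
          abs_det_fderiv_le (hdv x)
      _ ≤ (1 / 2) * K * frobeniusNormSq (fderiv ℝ v x) := by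
          gcongr
          · exact frobeniusNormSq_nonneg _
          · exact hK x
  have iP : Integrable (fun x => ⟪curl v x, fderiv ℝ v x (curl v x)⟫) volume := by
    refine Integrable.mono' (hfrob_int.const_mul (‖curlCLM‖ ^ 2 * K)) cP.aestronglyMeasurable
      (Eventually.of_forall fun x => ?_)
    rw [Real.norm_eq_abs]
    have hω : ‖curl v x‖ ≤ ‖curlCLM‖ * ‖fderiv ℝ v x‖ := norm_curl_le v x
    have hsq : ‖fderiv ℝ v x‖ ^ 2 ≤ frobeniusNormSq (fderiv ℝ v x) :=
      FluidPDE.sq_opNorm_le_frobeniusNormSq _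
    calc |⟪curl v x, fderiv ℝ v x (curl v x)⟫| ≤ ‖curl v x‖ * ‖fderiv ℝ v x (curl v x)‖ :=
          abs_real_inner_le_norm _ _
      _ ≤ ‖curl v x‖ * (‖fderiv ℝ v x‖ * ‖curl v x‖) := by gcongr; exact (fderiv ℝ v x).le_opNorm _
      _ = ‖fderiv ℝ v x‖ * ‖curl v x‖ ^ 2 := by ring
      _ ≤ ‖fderiv ℝ v x‖ * (‖curlCLM‖ * ‖fderiv ℝ v x‖) ^ 2 := by gcongr
      _ = ‖curlCLM‖ ^ 2 * ‖fderiv ℝ v x‖ * ‖fderiv ℝ v x‖ ^ 2 := by ring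
      _ ≤ ‖curlCLM‖ ^ 2 * K * frobeniusNormSq (fderiv ℝ v x) :=
          mul_le_mul (mul_le_mul_of_nonneg_left (hK x) (sq_nonneg _)) hsq (sq_nonneg _) (by positivity)
  -- Step 2: the class split of the production
  have hsplitP : ∫ x, ⟪curl v x, fderiv ℝ v x (curl v x)⟫ =
      (∫ x in S, ⟪curl v x, fderiv ℝ v x (curl v x)⟫) + ∫ x in F, ⟪curl v x, fderiv ℝ v x (curl v x)⟫ := by
    rw [← hSc, integral_add_compl hSm iP]
  -- Step 3: `∫_F det ∇v = 0` (global minus slow null-Lagrangian identities)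
  have hdetF : ∫ x in F, (fderiv ℝ v x).det = 0 := by
    have hglob : ∫ x, (fderiv ℝ v x).det = 0 := integral_det_fderiv_eq_zero hv2' hB hK hfrob_int
    have hslow : ∫ x in S, (fderiv ℝ v x).det = 0 :=
      setIntegral_slowClass_det_fderiv_eq_zero hv2' hB hK hfrob_int hl
    have h := integral_add_compl hSm idet
    rw [hSc, hglob, hslow, zero_add] at h
    exact h
  have hPF : ∫ x in F, ⟪curl v x, fderiv ℝ v x (curl v x)⟫ =
      ∫ x in F, (⟪curl v x, fderiv ℝ v x (curl v x)⟫ - 4 * (fderiv ℝ v x).det) := by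
    rw [integral_sub iP.integrableOn (idet.integrableOn.const_mul 4), integral_const_mul, hdetF,
      mul_zero, sub_zero]
  -- Step 4: the effective majorant `G = g 1_F` and the pointwise fast bound
  set g : EuclideanSpace ℝ (Fin 3) → ℝ := fun x =>
    max 0 (⟪curl v x, fderiv ℝ v x (curl v x)⟫ - 4 * (fderiv ℝ v x).det) /
      (2 * frobeniusNormSq (fderiv ℝ v x)) with hg
  set G : EuclideanSpace ℝ (Fin 3) → ℝ := F.indicator g with hG
  set MG : ℝ := (‖curlCLM‖ ^ 2 + 2) / 2 * K with hMG
  have hgm : Measurable g := measurable_effMajorant hv1'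
  have hGm : Measurable G := hgm.indicator hFm
  have hg0 : ∀ x, 0 ≤ g x := fun x => effMajorant_nonneg v x
  have hG0 : ∀ x, 0 ≤ G x := fun x => by
    rw [hG]; exact Set.indicator_nonneg (fun y _ => hg0 y) x
  have hgMG : ∀ x, g x ≤ MG := fun x =>
    (effMajorant_le_norm v (hdv x)).trans (by rw [hMG]; gcongr; exact hK x)
  have hMG0 : 0 ≤ MG := (hg0 0).trans (hgMG 0)
  have hGM : ∀ x, G x ≤ MG := fun x => by
    rw [hG]
    exact Set.indicator_apply_le' (fun _ => hgMG x) (fun _ => hMG0)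
  -- `G ≤ m` on `F` (Betchov–Miller), so `∫ G^p ≤ ∫_F m^p < ∞`
  have hgm_le : ∀ x ∈ F, g x ≤ m x := fun x hx =>
    effMajorant_le v x (hdiv' x) (hm0 x) (hcl x hx)
  have hGp_eq : ∫⁻ x, ENNReal.ofReal (G x) ^ p = ∫⁻ x in F, ENNReal.ofReal (g x) ^ p := by
    have hfun : (fun x => ENNReal.ofReal (G x) ^ p) = F.indicator (fun x => ENNReal.ofReal (g x) ^ p) := by
      funext x
      by_cases hx : x ∈ F
      · simp [hG, hx]
      · simp [hG, hx, ENNReal.zero_rpow_of_pos hp0]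
    rw [hfun, lintegral_indicator hFm]
  have hGp_le : ∫⁻ x, ENNReal.ofReal (G x) ^ p ≤ ∫⁻ x in F, ENNReal.ofReal (m x) ^ p := by
    rw [hGp_eq]
    refine setLIntegral_mono' hFm fun x hx => ?_
    exact ENNReal.rpow_le_rpow (ENNReal.ofReal_le_ofReal (hgm_le x hx)) hp0.le
  have hGp : ∫⁻ x, ENNReal.ofReal (G x) ^ p < ⊤ := lt_of_le_of_lt hGp_le hmp
  set NG : ℝ := ((∫⁻ x, ENNReal.ofReal (G x) ^ p) ^ (1 / p)).toReal with hNG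
  set Nm : ℝ := ((∫⁻ x in F, ENNReal.ofReal (m x) ^ p) ^ (1 / p)).toReal with hNm
  have hNG0 : 0 ≤ NG := ENNReal.toReal_nonneg
  have hNGm : NG ≤ Nm := by
    rw [hNG, hNm]
    refine ENNReal.toReal_mono (ENNReal.rpow_ne_top_of_nonneg (by positivity) hmp.ne) ?_
    exact ENNReal.rpow_le_rpow hGp_le (by positivity)
  -- Step 5: the fast-class bound `∫_F (P − 4 det) ≤ 2 Σⱼ ∫ G ‖∂ⱼv‖²`
  have cfrob : Continuous fun x => frobeniusNormSq (fderiv ℝ v x) :=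
    FluidPDE.continuous_frobeniusNormSq_fderiv hv (by simp)
  have hpt : ∀ x ∈ F, ⟪curl v x, fderiv ℝ v x (curl v x)⟫ - 4 * (fderiv ℝ v x).det ≤
      2 * G x * frobeniusNormSq (fderiv ℝ v x) := by
    intro x hx
    have h := effMajorant_bound v x
    rw [hG, indicator_of_mem hx]
    exact h
  have iGf : Integrable (fun x => 2 * G x * frobeniusNormSq (fderiv ℝ v x)) volume := by
    refine Integrable.mono' (hfrob_int.const_mul (2 * MG))
      (((measurable_const.mul hGm).aestronglyMeasurable).mul cfrob.aestronglyMeasurable)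
      (Eventually.of_forall fun x => ?_)
    rw [Real.norm_of_nonneg (by have := hG0 x; have := frobeniusNormSq_nonneg (fderiv ℝ v x); positivity)]
    have := frobeniusNormSq_nonneg (fderiv ℝ v x)
    gcongr
    exact hGM x
  have hF1 : ∫ x in F, (⟪curl v x, fderiv ℝ v x (curl v x)⟫ - 4 * (fderiv ℝ v x).det) ≤
      ∫ x in F, 2 * G x * frobeniusNormSq (fderiv ℝ v x) :=
    setIntegral_mono_on (iP.sub (idet.const_mul 4)).integrableOn iGf.integrableOn hFm hpt
  have hF2 : ∫ x in F, 2 * G x * frobeniusNormSq (fderiv ℝ v x) =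
      ∫ x, 2 * G x * frobeniusNormSq (fderiv ℝ v x) := by
    refine setIntegral_eq_integral_of_forall_compl_eq_zero fun x hx => ?_
    rw [hG, indicator_of_notMem hx]; ring
  -- `∫ 2 G |∇v|²_F = 2 Σⱼ ∫ G ‖∂ⱼ v‖²`
  have cdiv : ∀ j, Continuous fun x => fderiv ℝ v x (e j) := fun j => cDv.clm_apply continuous_const
  have l2div : ∀ j, ∫⁻ x, ‖fderiv ℝ v x (e j)‖ₑ ^ 2 < ⊤ := fun j =>
    lintegral_enorm_sq_lt_top_of_norm_le (fun x => by
      simpa [he] using (fderiv ℝ v x).le_opNorm (e j)) l2Dv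
  have i_a : ∀ j, Integrable (fun x => ‖fderiv ℝ v x (e j)‖ ^ 2) volume := fun j =>
    FluidPDE.integrable_sq_norm_of_lintegral_lt_top (cdiv j) (l2div j)
  have i_Ga : ∀ j, Integrable (fun x => G x * ‖fderiv ℝ v x (e j)‖ ^ 2) volume := by
    intro j
    refine Integrable.mono' ((i_a j).const_mul MG) (hGm.aestronglyMeasurable.mul ((cdiv j).norm.pow 2).aestronglyMeasurable)
      (Eventually.of_forall fun x => ?_)
    rw [Real.norm_of_nonneg (mul_nonneg (hG0 x) (sq_nonneg _))]
    exact mul_le_mul_of_nonneg_right (hGM x) (sq_nonneg _)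
  have hF3 : ∫ x, 2 * G x * frobeniusNormSq (fderiv ℝ v x) =
      2 * ∑ j, ∫ x, G x * ‖fderiv ℝ v x (e j)‖ ^ 2 := by
    rw [← integral_finsetSum _ fun j _ => i_Ga j, ← integral_const_mul]
    refine integral_congr_ae (Eventually.of_forall fun x => ?_)
    simp only
    rw [FluidPDE.frobeniusNormSq_eq_sum e, Finset.mul_sum, Finset.mul_sum]
    refine Finset.sum_congr rfl fun j _ => ?_
    ring
  -- Step 6: the weighted Gagliardo–Nirenberg absorption
  have habs := two_mul_sum_integral_weight_le hν hv hv1 hv2 hv3 hGm hG0 hGM hp hGp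
  -- Step 7: assemble
  have hΔ0 : 0 ≤ ∫ x, ‖(Δ v) x‖ ^ 2 := integral_nonneg fun x => sq_nonneg _
  have hfrob0 : 0 ≤ ∫ x, frobeniusNormSq (fderiv ℝ v x) :=
    integral_nonneg fun x => FluidPDE.frobeniusNormSq_nonneg _
  have h1θ : 0 < 1 - θ := by linarith
  have hC0 : 0 ≤ θ * (2 * (1 - θ)) ^ ((1 - θ) / θ) * ν ^ (-((1 - θ) / θ)) := by positivity
  have hmonoN : (2 * NG * KS ^ (2 * (1 - θ))) ^ (1 / θ) ≤ (2 * Nm * KS ^ (2 * (1 - θ))) ^ (1 / θ) := by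
    refine Real.rpow_le_rpow (by positivity) ?_ (by positivity)
    gcongr
  have hfast : ∫ x in F, ⟪curl v x, fderiv ℝ v x (curl v x)⟫ ≤
      ν / 2 * (∫ x, ‖(Δ v) x‖ ^ 2) +
        θ * (2 * (1 - θ)) ^ ((1 - θ) / θ) * ν ^ (-((1 - θ) / θ)) *
          (2 * Nm * KS ^ (2 * (1 - θ))) ^ (1 / θ) * ∫ x, frobeniusNormSq (fderiv ℝ v x) := by
    rw [hPF]
    refine (hF1.trans_eq (hF2.trans hF3)).trans (habs.trans ?_)
    gcongr
  rw [← he] at hprod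
  rw [hprod, hsplitP]
  nlinarith [hfast, hΔ0, hν, mul_nonneg hC0 (mul_nonneg (Real.rpow_nonneg (by positivity : (0:ℝ) ≤ 2 * Nm * KS ^ (2 * (1 - θ))) (1 / θ)) hfrob0)]

/-- **The class-budget ledger at a fixed time, registered helper-stub form** (the `∀`-closed statement
of `classLedger_slice`). [cite: Miller2019, Thm 1.1 (proof of Thm 5.2) and Lemma 5.1] -/
theorem class_ledger_slice :
    ∀ (ν : ℝ), 0 < ν → ∀ (v W : EuclideanSpace ℝ (Fin 3) → EuclideanSpace ℝ (Fin 3))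
      (q : EuclideanSpace ℝ (Fin 3) → ℝ), ContDiff ℝ 3 v → ContDiff ℝ 1 W → ContDiff ℝ 1 q →
      (∀ x, W x + FluidPDE.convect v v x = ν • (Δ v) x - gradient q x) →
      VectorCalculus.IsDivFree v → (∃ B : ℝ, ∀ x, ‖v x‖ ≤ B) → (∃ K : ℝ, ∀ x, ‖fderiv ℝ v x‖ ≤ K) →
      (∫⁻ x, ‖iteratedFDeriv ℝ 1 v x‖ₑ ^ 2 < ⊤) → (∫⁻ x, ‖iteratedFDeriv ℝ 2 v x‖ₑ ^ 2 < ⊤) →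
      (∫⁻ x, ‖iteratedFDeriv ℝ 3 v x‖ₑ ^ 2 < ⊤) →
      (∫⁻ x, ‖W x‖ₑ ^ 2 < ⊤) → (∫⁻ x, ‖iteratedFDeriv ℝ 1 W x‖ₑ ^ 2 < ⊤) →
      (∫⁻ x, ‖q x‖ₑ ^ 2 < ⊤) → (∫⁻ x, ‖iteratedFDeriv ℝ 1 q x‖ₑ ^ 2 < ⊤) →
      ∀ l : ℝ, 0 < l → ∀ m : EuclideanSpace ℝ (Fin 3) → ℝ, (∀ x, 0 ≤ m x) →
      (∀ x, l < ‖v x‖ → ∃ a b : EuclideanSpace ℝ (Fin 3), ‖a‖ = 1 ∧ ‖b‖ = 1 ∧ inner ℝ a b = 0 ∧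
        ∀ α β : ℝ, inner ℝ (fderiv ℝ v x (α • a + β • b)) (α • a + β • b) ≤ m x * (α ^ 2 + β ^ 2)) →
      ∀ p : ℝ, 3 / 2 < p → (∫⁻ x in {x | l < ‖v x‖}, ENNReal.ofReal (m x) ^ p < ⊤) →
      ∫ x, ∑ i, inner ℝ (fderiv ℝ v x (EuclideanSpace.basisFun (Fin 3) ℝ i))
          (fderiv ℝ W x (EuclideanSpace.basisFun (Fin 3) ℝ i)) ≤
        (∫ x in {x | ‖v x‖ ≤ l}, inner ℝ (curl v x) (fderiv ℝ v x (curl v x))) +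
          (1 - 3 / (2 * p)) * (2 * (1 - (1 - 3 / (2 * p)))) ^ ((1 - (1 - 3 / (2 * p))) / (1 - 3 / (2 * p))) *
            ν ^ (-((1 - (1 - 3 / (2 * p))) / (1 - 3 / (2 * p)))) *
            (2 * ((∫⁻ x in {x | l < ‖v x‖}, ENNReal.ofReal (m x) ^ p) ^ (1 / p)).toReal *
              ((SNormLESNormFDerivOfEqConst (EuclideanSpace ℝ (Fin 3))
                (MeasureTheory.volume : MeasureTheory.Measure (EuclideanSpace ℝ (Fin 3))) 2 : ℝ) ^
                  (2 * (1 - (1 - 3 / (2 * p)))))) ^ (1 / (1 - 3 / (2 * p))) *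
            ∫ x, frobeniusNormSq (fderiv ℝ v x) := by
  intro ν hν v W q hv hW hq hmom hdiv hB hK hv1 hv2 hv3 hW0 hW1 hq0 hq1 l hl m hm0 hcl p hp hmp
  obtain ⟨B, hB⟩ := hB
  obtain ⟨K, hK⟩ := hK
  exact classLedger_slice hν hv hW hq hmom hdiv hB hK hv1 hv2 hv3 hW0 hW1 hq0 hq1 hl hm0 hcl hp hmp

end Summit.NavierStokesRegularity.NavierStokesRegularity.Theorems.ClassBudgetsRegularise

end
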